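import Summits.NavierStokesRegularity.NavierStokesRegularity.Theorems.TypeITraceScarL3.Negative.StubCSpreadWitnessTypeI
import HarnessLib

/-!
# Stub C of crux `TypeITraceScarL3` (stmt-NavierStokesRegularity-18385) is FALSE without its
# Navier–Stokes clause: a kinematic SPREAD extinct Type-I apex

Negative-lane lemma of the disprover seat `cdisprove-stmt-NavierStokesRegularity-18385` (`--supports` the
item; crux work file `Cruxes/TypeITraceScarL3/Disproof.lean`).  Line `apex-dichotomy` (skeleton sha16
95aa062ef93d7802): after Stubs 1, 2′, B (p576636, p583907, p585263) and the composition p585751 the item is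
Stub C `stub_no_spreadExtinctApex`: for `U, P, G, M, D₀, C` with (sw) `U, P` suitable weak in every `Q(a)`
at the origin, (G) `G` a weak spatial gradient of `U` on every `Q(a)`, (I) `𝐈(Q(a)) ≤ M`, (D) `D ≤ D₀` on
late cylinders, (R) the rate `‖U(s)‖ ≤ C/√(−s)` a.e., (T) weakly null top, (S) SPREAD (essentially
unbounded on every late exterior region), the origin is not backward singular.

LOAD-BEARING CENSUS, the one clause that is load-bearing OUTRIGHT: **(sw)**.
`exists_kinematic_spreadExtinctApex` exhibits `U, P = 0, G, M, D₀ = 0, C = 2` satisfying (G), (I), (D), (R),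
(T), (S) with a backward-SINGULAR origin — so Stub C minus (sw) is false, and any proof of Stub C must use
the Navier–Stokes equations / local energy inequality (not only the Type-I bookkeeping, the rate, the null
top and the spread geometry).  Compare the companion census `StubCCoreIsLocalTypeI`: every OTHER clause is
load-bearing at most modulo the open existence of a local Type-I singularity.

THE WITNESS.  `V = apexVelocity` is the tree's parabolic bump (`KinematicApexWitness`: amplitude
`(−t)^{−1/2} χ(|x|²/(−t))` along a fixed unit vector, supported in `‖x‖ ≤ √(2(−t))`, `𝐈 < ⊤` with pressure
`0`, rate `1/√(−t)`, backward-singular origin).  The witness is `U = V + W` with the TRAVELLING COPY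
`W(t, x) = V(t, x − c(t))`, `c(t) = (−t)⁻¹ e`: a second Type-I bump whose centre escapes to spatial
infinity as `t → 0⁻`.  Then: (G) `U` is smooth on the open slab `t < 0`, so `∇V + ∇W` is a weak gradient
on every `Q(a)`; (I) the scale-invariant quantities are translation invariant and subadditive up to
constants — `A ≤ 32|B₁|`, `C ≤ 64|B₁|`, `E ≤ 3072 L²|B₁|` (`L = sup|χ′|`), `D = 0` — on EVERY cylinder in
the lower half-space, uniformly; (R) `‖U‖ ≤ 2/√(−t)`; (T) `|∫⟨U(s), φ⟩| ≤ 16‖φ‖_∞|B₁|(−s) → 0`; (S) at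
`(t, c(t))`, `−1/4 ≤ t < 0`, `‖U‖ = 1/√(−t)` while `‖c(t)‖ = 1/(−t) → ∞`, and `U` is continuous, so
`{‖U‖ > K}` meets every `]−δ,0[ × {‖y‖ > R}` in an open non-empty (hence non-null) set; the origin is
singular because `W = 0` on `Q(1/2)` and `V` is singular there.  `U` is NOT a Navier–Stokes solution
(nor divergence-free) — exactly the dropped clause.

INFORMAL CONTENT for the line: the SPREAD alternative of the apex dichotomy is NOT excluded by the
function-analytic frame of Stub C (Type-I bounds + rate + null top + spread); shape (β) of the vacuity
verdict — a Type-I concentration marching to `|y| → ∞` as `s → 0⁻` — is kinematically consistent with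
every non-PDE clause.  Whether a suitable weak solution can do this is the open content (C1 of
`no_spreadExtinctApex_of_C1`, p587698).  WHAT THIS IS NOT: not ¬Stub C, not a statement about
Navier–Stokes solutions, not NS regularity (neither proved nor refuted here).  References: D. Albritton,
T. Barker, Arch. Ration. Mech. Anal. 232 (2019), §1 [AlbrittonBarker2019]; G. Koch, N. Nadirashvili,
G. Seregin, V. Šverák, Acta Math. 203 (2009), (1.4) [KNSS2009].
-/

noncomputable section

set_option linter.dupNamespace false

namespace Summit.NavierStokesRegularity.NavierStokesRegularity.Theorems.TypeITraceScarL3.Negative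

open MeasureTheory Set Function Filter Topology Metric TopologicalSpace
open Literature.Analysis.FluidPDE Literature.Analysis.FluidPDE.ParabolicBump
open scoped NNReal ENNReal InnerProductSpace RealInnerProductSpace

/-! ### The singular origin -/

/-- On `Q(1/2)` at the origin the witness is the parabolic bump. [folklore] -/
theorem spreadVelocity_eq_apex_of_mem {ρ : ℝ} (hρ : ρ ≤ 1 / 2)
    {q : ℝ × EuclideanSpace ℝ (Fin 3)}
    (hq : q ∈ parabolicCylinder ρ (0 : ℝ × EuclideanSpace ℝ (Fin 3))) :
    spreadVelocity q.1 q.2 = apexVelocity q.1 q.2 := by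
  rw [mem_parabolicCylinder] at hq
  obtain ⟨⟨h1, h2⟩, h3⟩ := hq
  simp only [Prod.fst_zero, Prod.snd_zero, zero_sub, dist_zero_right] at h1 h2 h3
  have hρ0 : 0 < ρ := (norm_nonneg _).trans_lt h3
  have hρ2 : ρ ^ 2 ≤ 1 / 4 := by nlinarith
  rw [spreadVelocity, travelVelocity_eq_zero_near_origin h2 (by linarith) (by linarith), add_zero]

/-- **The origin is backward singular** for the witness (it is for the bump, and `W = 0` near it). [folklore] -/
theorem spread_isBackwardSingularPoint :
    IsBackwardSingularPoint spreadVelocity (0 : ℝ × EuclideanSpace ℝ (Fin 3)) := by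
  intro r hr
  set ρ : ℝ := min r (1 / 2) with hρ
  have hρ0 : 0 < ρ := lt_min hr (by norm_num)
  have hρr : ρ ≤ r := min_le_left _ _
  have hρh : ρ ≤ 1 / 2 := min_le_right _ _
  have hmono : eLpNorm (uncurry spreadVelocity) ∞
        (volume.restrict (parabolicCylinder ρ (0 : ℝ × EuclideanSpace ℝ (Fin 3)))) ≤
      eLpNorm (uncurry spreadVelocity) ∞
        (volume.restrict (parabolicCylinder r (0 : ℝ × EuclideanSpace ℝ (Fin 3)))) :=
    eLpNorm_mono_measure _ (Measure.restrict_mono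
      (Set.prod_mono (Ioo_subset_Ioo (by simp only [Prod.fst_zero]; nlinarith) le_rfl)
        (ball_subset_ball hρr)) le_rfl)
  have heq : eLpNorm (uncurry spreadVelocity) ∞
        (volume.restrict (parabolicCylinder ρ (0 : ℝ × EuclideanSpace ℝ (Fin 3)))) =
      eLpNorm (uncurry apexVelocity) ∞
        (volume.restrict (parabolicCylinder ρ (0 : ℝ × EuclideanSpace ℝ (Fin 3)))) := by
    refine eLpNorm_congr_ae ?_
    filter_upwards [ae_restrict_mem (measurableSet_Ioo.prod measurableSet_ball)] with q hq
    exact spreadVelocity_eq_apex_of_mem hρh hq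
  rw [heq, apex_isBackwardSingularPoint ρ hρ0] at hmono
  exact top_le_iff.1 hmono

/-! ### The weakly null top -/

/-- `|V(t,y)| ≤ (−t)^{−1/2} 𝟙_{B(0,2√(−t))}(y)`. [folklore] -/
theorem norm_apexVelocity_le_indicator {t : ℝ} (ht : t < 0) (y : EuclideanSpace ℝ (Fin 3)) :
    ‖apexVelocity t y‖ ≤ 1 / Real.sqrt (-t) *
      (ball (0 : EuclideanSpace ℝ (Fin 3)) (2 * Real.sqrt (-t))).indicator (fun _ => (1 : ℝ)) y := by
  by_cases hy : y ∈ ball (0 : EuclideanSpace ℝ (Fin 3)) (2 * Real.sqrt (-t))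
  · rw [indicator_of_mem hy, mul_one]; exact norm_apexVelocity_le t y
  · rw [indicator_of_notMem hy, mul_zero]
    have hy' : 2 * Real.sqrt (-t) ≤ ‖y‖ := by simpa [mem_ball, dist_zero_right] using hy
    rw [apexVelocity_eq_zero_of ht hy', norm_zero]

/-- `|W(t,y)| ≤ (−t)^{−1/2} 𝟙_{B(c(t),2√(−t))}(y)`. [folklore] -/
theorem norm_travelVelocity_le_indicator {t : ℝ} (ht : t < 0) (y : EuclideanSpace ℝ (Fin 3)) :
    ‖travelVelocity t y‖ ≤ 1 / Real.sqrt (-t) *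
      (ball (driftCentre t) (2 * Real.sqrt (-t))).indicator (fun _ => (1 : ℝ)) y := by
  by_cases hy : y ∈ ball (driftCentre t) (2 * Real.sqrt (-t))
  · rw [indicator_of_mem hy, mul_one]; exact norm_travelVelocity_le t y
  · rw [indicator_of_notMem hy, mul_zero]
    have hy' : 2 * Real.sqrt (-t) ≤ ‖y - driftCentre t‖ := by
      rw [mem_ball_iff_norm, not_lt] at hy; exact hy
    rw [travelVelocity_eq_zero_of ht hy', norm_zero]

/-- Real volume of balls in `ℝ³`. [folklore] -/
theorem volume_ball_toReal (c : EuclideanSpace ℝ (Fin 3)) {ρ : ℝ} (hρ : 0 < ρ) :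
    (volume (ball c ρ)).toReal = ρ ^ 3 * (volume (ball (0 : EuclideanSpace ℝ (Fin 3)) 1)).toReal := by
  rw [volume_ball_three c hρ, ENNReal.toReal_mul, ENNReal.toReal_ofReal (by positivity)]

/-- `∫ 𝟙_{B(c,ρ)} = |B(c,ρ)|`. [folklore] -/
theorem integral_ball_indicator_one (c : EuclideanSpace ℝ (Fin 3)) (ρ : ℝ) :
    ∫ y, (ball c ρ).indicator (fun _ => (1 : ℝ)) y = (volume (ball c ρ)).toReal := by
  rw [integral_indicator_const _ measurableSet_ball, smul_eq_mul, mul_one]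
  rfl

/-- `𝟙_{B(c,ρ)}` is integrable. [folklore] -/
theorem integrable_ball_indicator_one (c : EuclideanSpace ℝ (Fin 3)) (ρ : ℝ) :
    Integrable (fun y => (ball c ρ).indicator (fun _ => (1 : ℝ)) y) volume :=
  (integrable_indicator_iff measurableSet_ball).2
    (integrableOn_const (measure_ball_lt_top (μ := volume) (x := c) (r := ρ)).ne)

/-- `|∫ ⟨U(s), φ⟩| ≤ 16 M_φ |B₁| (−s)` for `s < 0`. [folklore] -/
theorem abs_integral_inner_spread_le {φ : EuclideanSpace ℝ (Fin 3) → EuclideanSpace ℝ (Fin 3)}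
    {Mφ : ℝ} (hMφ : ∀ y, ‖φ y‖ ≤ Mφ) {s : ℝ} (hs : s < 0) :
    |∫ y, ⟪spreadVelocity s y, φ y⟫| ≤
      16 * Mφ * (volume (ball (0 : EuclideanSpace ℝ (Fin 3)) 1)).toReal * (-s) := by
  have hM0 : 0 ≤ Mφ := (norm_nonneg _).trans (hMφ 0)
  have hns : 0 < -s := by linarith
  have hσ : 0 < Real.sqrt (-s) := Real.sqrt_pos.2 hns
  set V₁r : ℝ := (volume (ball (0 : EuclideanSpace ℝ (Fin 3)) 1)).toReal with hV₁r
  set g : EuclideanSpace ℝ (Fin 3) → ℝ := fun y => Mφ * (1 / Real.sqrt (-s)) *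
    ((ball (0 : EuclideanSpace ℝ (Fin 3)) (2 * Real.sqrt (-s))).indicator (fun _ => (1 : ℝ)) y +
      (ball (driftCentre s) (2 * Real.sqrt (-s))).indicator (fun _ => (1 : ℝ)) y) with hg
  have hbound : ∀ y, ‖⟪spreadVelocity s y, φ y⟫‖ ≤ g y := by
    intro y
    rw [Real.norm_eq_abs]
    calc |⟪spreadVelocity s y, φ y⟫| ≤ ‖spreadVelocity s y‖ * ‖φ y‖ := abs_real_inner_le_norm _ _
      _ ≤ (‖apexVelocity s y‖ + ‖travelVelocity s y‖) * Mφ :=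
          mul_le_mul (norm_add_le _ _) (hMφ y) (norm_nonneg _) (by positivity)
      _ ≤ (1 / Real.sqrt (-s) *
              (ball (0 : EuclideanSpace ℝ (Fin 3)) (2 * Real.sqrt (-s))).indicator (fun _ => (1 : ℝ)) y +
            1 / Real.sqrt (-s) *
              (ball (driftCentre s) (2 * Real.sqrt (-s))).indicator (fun _ => (1 : ℝ)) y) * Mφ := by
          gcongr
          · exact norm_apexVelocity_le_indicator hs y
          · exact norm_travelVelocity_le_indicator hs y
      _ = g y := by rw [hg]; ring
  have hint : Integrable g volume :=
    ((integrable_ball_indicator_one _ _).add (integrable_ball_indicator_one _ _)).const_mul _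
  have h1 : ‖∫ y, ⟪spreadVelocity s y, φ y⟫‖ ≤ ∫ y, g y :=
    norm_integral_le_of_norm_le hint (Eventually.of_forall hbound)
  rw [Real.norm_eq_abs] at h1
  refine h1.trans (le_of_eq ?_)
  rw [hg, integral_const_mul, integral_add (integrable_ball_indicator_one _ _)
    (integrable_ball_indicator_one _ _), integral_ball_indicator_one, integral_ball_indicator_one,
    volume_ball_toReal (driftCentre s) (by positivity : (0 : ℝ) < 2 * Real.sqrt (-s)),
    volume_ball_toReal (0 : EuclideanSpace ℝ (Fin 3)) (by positivity : (0 : ℝ) < 2 * Real.sqrt (-s)),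
    ← hV₁r, two_sqrt_cube hs]
  field_simp
  ring

/-- **Weakly (indeed uniformly-in-`L¹_loc`) null top**: `∫ ⟨U(s), φ⟩ → 0` as `s → 0⁻`. [folklore] -/
theorem spread_nullTop (φ : EuclideanSpace ℝ (Fin 3) → EuclideanSpace ℝ (Fin 3))
    (hφ : ContDiff ℝ (⊤ : ℕ∞) φ) (hφc : HasCompactSupport φ) (ε : ℝ) (hε : 0 < ε) :
    ∃ s₀ : ℝ, s₀ < 0 ∧ ∀ᵐ s ∂(volume.restrict (Ioo s₀ 0)),
      |∫ y, ⟪spreadVelocity s y, φ y⟫| ≤ ε := by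
  obtain ⟨Mφ, hMφ⟩ := hφ.continuous.bounded_above_of_compact_support hφc
  have hM0 : 0 ≤ Mφ := (norm_nonneg _).trans (hMφ 0)
  set V₁r : ℝ := (volume (ball (0 : EuclideanSpace ℝ (Fin 3)) 1)).toReal with hV₁r
  have hV0 : 0 ≤ V₁r := ENNReal.toReal_nonneg
  have hden : 0 < 16 * Mφ * V₁r + 1 := by positivity
  refine ⟨-(ε / (16 * Mφ * V₁r + 1)), by rw [neg_lt_zero]; positivity, ?_⟩
  refine (ae_restrict_iff' measurableSet_Ioo).2 (Eventually.of_forall fun s hs => ?_)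
  refine (abs_integral_inner_spread_le hMφ hs.2).trans ?_
  rw [← hV₁r]
  have h1 : -s < ε / (16 * Mφ * V₁r + 1) := by linarith [hs.1]
  calc 16 * Mφ * V₁r * (-s) ≤ 16 * Mφ * V₁r * (ε / (16 * Mφ * V₁r + 1)) := by
        gcongr
    _ = ε * (16 * Mφ * V₁r / (16 * Mφ * V₁r + 1)) := by ring
    _ ≤ ε * 1 := by
        gcongr
        rw [div_le_one hden]; linarith
    _ = ε := mul_one ε

/-! ### The witness is SPREAD -/

/-- **Spread**: on no late exterior region `]−δ,0[ × {‖y‖ > R}` is the witness essentially bounded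
(the travelling copy carries the value `1/√(−t)` at `c(t)`, `‖c(t)‖ = 1/(−t) → ∞`). [folklore] -/
theorem spread_isSpread (δ : ℝ) (hδ : 0 < δ) (R K : ℝ) :
    ¬ (∀ᵐ z ∂(volume.restrict (Ioo (-δ) 0 ×ˢ (closedBall (0 : EuclideanSpace ℝ (Fin 3)) R)ᶜ)),
      ‖spreadVelocity z.1 z.2‖ ≤ K) := by
  intro h
  set O : Set (ℝ × EuclideanSpace ℝ (Fin 3)) :=
    Ioo (-δ) 0 ×ˢ (closedBall (0 : EuclideanSpace ℝ (Fin 3)) R)ᶜ with hO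
  have hOo : IsOpen O := isOpen_Ioo.prod isClosed_closedBall.isOpen_compl
  have hOsub : O ⊆ Iio 0 ×ˢ univ := fun z hz => ⟨hz.1.2, mem_univ _⟩
  have hcont : ContinuousOn (fun z : ℝ × EuclideanSpace ℝ (Fin 3) => ‖spreadVelocity z.1 z.2‖) O :=
    ((contDiffOn_spreadVelocity (n := 0)).continuousOn.mono hOsub).norm
  set Bad : Set (ℝ × EuclideanSpace ℝ (Fin 3)) :=
    O ∩ (fun z : ℝ × EuclideanSpace ℝ (Fin 3) => ‖spreadVelocity z.1 z.2‖) ⁻¹' Ioi K with hBad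
  have hBo : IsOpen Bad := hcont.isOpen_inter_preimage hOo isOpen_Ioi
  -- the escaping point `(−τ, c(−τ))`
  set τ : ℝ := min (δ / 2) (min (1 / 4) (min (1 / (|R| + 1)) (1 / (|K| + 1) ^ 2))) with hτ
  have hR1 : 0 < |R| + 1 := by positivity
  have hK1 : 0 < |K| + 1 := by positivity
  have hτ0 : 0 < τ := lt_min (by positivity) (lt_min (by norm_num) (lt_min (by positivity) (by positivity)))
  have hτδ : τ ≤ δ / 2 := min_le_left _ _
  have hτ4 : τ ≤ 1 / 4 := (min_le_right _ _).trans (min_le_left _ _)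
  have hτR : τ ≤ 1 / (|R| + 1) := ((min_le_right _ _).trans (min_le_right _ _)).trans (min_le_left _ _)
  have hτK : τ ≤ 1 / (|K| + 1) ^ 2 := ((min_le_right _ _).trans (min_le_right _ _)).trans (min_le_right _ _)
  have hmem : ((-τ : ℝ), driftCentre (-τ)) ∈ Bad := by
    refine ⟨⟨⟨by linarith, by linarith⟩, ?_⟩, ?_⟩
    · rw [mem_compl_iff, mem_closedBall, dist_zero_right, not_le, norm_driftCentre (by linarith), neg_neg]
      have h1 : |R| + 1 ≤ τ⁻¹ := by
        rw [le_inv_comm₀ hR1 hτ0, inv_eq_one_div]; exact hτR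
      linarith [le_abs_self R]
    · show K < ‖spreadVelocity (-τ) (driftCentre (-τ))‖
      rw [norm_spreadVelocity_driftCentre (by linarith) (by linarith), neg_neg]
      have hsq : Real.sqrt τ ≤ 1 / (|K| + 1) := by
        rw [Real.sqrt_le_left (by positivity), div_pow, one_pow]; exact hτK
      have hsq0 : 0 < Real.sqrt τ := Real.sqrt_pos.2 hτ0
      have h1 : |K| + 1 ≤ 1 / Real.sqrt τ := by
        rw [le_div_iff₀ hsq0]
        calc (|K| + 1) * Real.sqrt τ ≤ (|K| + 1) * (1 / (|K| + 1)) := by gcongr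
          _ = 1 := by field_simp
      linarith [le_abs_self K]
  have hpos : 0 < volume Bad := hBo.measure_pos volume ⟨_, hmem⟩
  have hnull : volume Bad = 0 := by
    have h2 := (ae_restrict_iff' hOo.measurableSet).1 h
    rw [ae_iff] at h2
    refine measure_mono_null (fun z hz => ?_) h2
    rw [mem_setOf_eq, Classical.not_imp, not_le]
    exact ⟨hz.1, hz.2⟩
  exact hpos.ne' hnull

/-! ### Assembly: Stub C minus its Navier–Stokes clause is false -/

/-- **Stub C (`stub_no_spreadExtinctApex` of line `apex-dichotomy`, crux `TypeITraceScarL3`) is FALSE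
without its Navier–Stokes clause (sw)**: there are `U, P = 0, G, M, D₀ = 0, C = 2` satisfying the
six remaining clauses — (G) weak gradient on every `Q(a)`, (I) `𝐈(Q(a)) ≤ M` for all `a > 0`,
(D) `D ≤ D₀` on all late cylinders, (R) the rate `‖U(s)‖ ≤ C/√(−s)`, (T) weakly null top,
(S) spread — whose origin IS backward singular.  Any proof of Stub C must use the equations. [folklore] -/
theorem exists_kinematic_spreadExtinctApex :
    ∃ (U : ℝ → EuclideanSpace ℝ (Fin 3) → EuclideanSpace ℝ (Fin 3))
      (P : ℝ → EuclideanSpace ℝ (Fin 3) → ℝ)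
      (G : ℝ → EuclideanSpace ℝ (Fin 3) → EuclideanSpace ℝ (Fin 3) →L[ℝ] EuclideanSpace ℝ (Fin 3))
      (M D₀ : ℝ≥0) (C : ℝ),
      (∀ a : ℝ, 0 < a →
        HasWeakSpatialGradientOn
          (parabolicCylinderOpens a (0 : ℝ × EuclideanSpace ℝ (Fin 3))) U G) ∧
      (∀ a : ℝ, 0 < a →
        typeIBound (parabolicCylinder a (0 : ℝ × EuclideanSpace ℝ (Fin 3))) U P G ≤ M) ∧
      (∀ z₀ : ℝ × EuclideanSpace ℝ (Fin 3), z₀.1 ≤ 0 → ∀ r : ℝ, 0 < r → cknD r z₀ P ≤ D₀) ∧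
      (∀ s : ℝ, s < 0 → ∀ᵐ y : EuclideanSpace ℝ (Fin 3), ‖U s y‖ ≤ C / Real.sqrt (-s)) ∧
      (∀ φ : EuclideanSpace ℝ (Fin 3) → EuclideanSpace ℝ (Fin 3), ContDiff ℝ (⊤ : ℕ∞) φ →
        HasCompactSupport φ → ∀ ε : ℝ, 0 < ε →
        ∃ s₀ : ℝ, s₀ < 0 ∧ ∀ᵐ s ∂(volume.restrict (Ioo s₀ 0)), |∫ y, ⟪U s y, φ y⟫| ≤ ε) ∧
      (∀ δ : ℝ, 0 < δ → ∀ R K : ℝ,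
        ¬ (∀ᵐ z ∂(volume.restrict
            (Ioo (-δ) 0 ×ˢ (closedBall (0 : EuclideanSpace ℝ (Fin 3)) R)ᶜ)), ‖U z.1 z.2‖ ≤ K)) ∧
      IsBackwardSingularPoint U (0 : ℝ × EuclideanSpace ℝ (Fin 3)) := by
  obtain ⟨M, hM⟩ := typeIBound_spread_cylinder_le
  refine ⟨spreadVelocity, 0, spreadGradient, M, 0, 2, fun a _ => spread_hasWeakSpatialGradientOn a,
    fun a _ => hM a, fun z₀ _ r _ => (cknD_zero r z₀).le, fun s _ => Eventually.of_forall
      fun y => norm_spreadVelocity_le s y, spread_nullTop, spread_isSpread,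
    spread_isBackwardSingularPoint⟩

end Summit.NavierStokesRegularity.NavierStokesRegularity.Theorems.TypeITraceScarL3.Negative

end
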